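import Mathlib
import Summits.RiemannHypothesis.RiemannHypothesis.Theorems.HandoffRealZeroCount
import Summits.RiemannHypothesis.RiemannHypothesis.Theorems.HandoffXiZeroCount
import Literature.NumberTheory.LFunctions.RiemannXiProofs
import Literature.NumberTheory.LFunctions.ZetaZeros
import Literature.Analysis.Complex.FourierPolyaKiKimEngine
import HarnessLib

/-!
# ROUTE R-K «COUNT-AND-THIN», REAL-AXIS FORM: `C^{N(T)}`-convergence on `[0, T]` replaces the thin strip

Handoff track (ROUTE 1′), prove-1 gen13; companion of `HandoffCountThin.lean` (idea-3 gen22 ROUTE R-K,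
TASK H-K1; HOME/handoff/IDEAS-finite-rank.md v3.3.1 §G22-3/§G22-4).

The proof of G22-T (`CountThin.riemannHypothesis_of_count_of_thin`) uses the thin complex rectangles
of SC-3 ONLY to obtain, by Weierstrass, convergence of the real functions `x ↦ Re(e^{-α_t} û_t(x))`
to `x ↦ Ξ(x)` together with finitely many derivatives on `[0, T]`. This file records the resulting
SHARPER statement, in which the approximants are arbitrary REAL `C^k` functions `g_t : ℝ → ℝ` and
no complex analysis is assumed of them:

* `im_eq_zero_of_count_of_smoothConvergence` — one window: if eventually
  `#{x ∈ (0,T] : g_t(x) = 0} = N(T)` (`N(T) = zetaZeroCount T`, with multiplicity) and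
  `g_t^{(k)} → (Ξ|_ℝ)^{(k)}` uniformly on `[0, T]` for every `k ≤ N(T)`, each `g_t` being `C^{N(T)}`,
  then `Ξ` has no non-real zero with `0 < Re z ≤ T`;
* `riemannHypothesis_of_count_of_smoothConvergence` — all windows: SC-2 ∧ «`C^∞_loc`-convergence on the
  real half-axis» ⟹ `RiemannHypothesis`.

So in idea-3's pair the conjunct SC-3 («thin») may be thinned to the real axis itself, at the price of
derivatives up to order `N(T)` on `[0, T]`; SC-3 as printed implies this form
(`RealZeroCount.tendstoUniformlyOn_re_iteratedDeriv`). A pure implication between statements about an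
unspecified family and RH; nothing here is, or suggests, a proof of RH.
-/

set_option linter.dupNamespace false  -- the mandated namespace repeats `RiemannHypothesis`

noncomputable section

open Filter Set Topology Metric Complex
open scoped BigOperators
open Literature.NumberTheory.LFunctions Literature.Analysis.Complex.KiKim

namespace Summit.RiemannHypothesis.RiemannHypothesis.Theorems

namespace CountThin

open RealZeroCount

/-- **G22-T, real-axis form, one window.** Let `g_t : ℝ → ℝ` be `C^{N(T)}` functions such that
eventually `#{x ∈ (0, T] : g_t(x) = 0} = N(T)` and `g_t^{(k)} → (x ↦ Ξ(x))^{(k)}` uniformly on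
`[0, T]` for every `k ≤ N(T)`. Then every zero of `Ξ` with `0 < Re z ≤ T` is real. -/
theorem im_eq_zero_of_count_of_smoothConvergence {g : ℝ → ℝ → ℝ} {T : ℝ}
    (hsmooth : ∀ᶠ t : ℝ in atTop, ContDiff ℝ (zetaZeroCount T : ℕ) (g t))
    (hC : ∀ᶠ t : ℝ in atTop,
      {x : ℝ | 0 < x ∧ x ≤ T ∧ g t x = 0}.encard = (zetaZeroCount T : ℕ∞))
    (hconv : ∀ k : ℕ, k ≤ zetaZeroCount T →
      TendstoUniformlyOn (fun t => iteratedDeriv k (g t))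
        (iteratedDeriv k fun x : ℝ => (riemannXiUpper x).re) atTop (Icc 0 T)) :
    ∀ z : ℂ, riemannXiUpper z = 0 → 0 < z.re → z.re ≤ T → z.im = 0 := by
  classical
  set f : ℝ → ℝ := fun x => (riemannXiUpper x).re with hf
  set B := (xiZeros_finite T).toFinset with hB
  set Z : Finset ℝ := (B.filter fun z => z.im = 0).image Complex.re with hZ
  set k : ℝ → ℕ := fun c => analyticOrderNatAt riemannXiUpper (c : ℂ) with hk
  have hΞreal := im_riemannXiUpper_ofReal_holds
  have hΞd := differentiable_riemannXiUpper'
  -- bookkeeping: the box sum is `N(T)`; its real part is `∑_{c ∈ Z} k c`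
  have hsplit : ∑ z ∈ B, analyticOrderNatAt riemannXiUpper z
      = ∑ z ∈ B.filter (fun z => z.im = 0), analyticOrderNatAt riemannXiUpper z
        + ∑ z ∈ B.filter (fun z => ¬ z.im = 0), analyticOrderNatAt riemannXiUpper z :=
    (Finset.sum_filter_add_sum_filter_not B _ _).symm
  have hreal_sum : ∑ c ∈ Z, k c
      = ∑ z ∈ B.filter (fun z => z.im = 0), analyticOrderNatAt riemannXiUpper z := by
    rw [hZ, Finset.sum_image]
    · refine Finset.sum_congr rfl fun z hz => ?_
      have hz0 : z.im = 0 := (Finset.mem_filter.mp hz).2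
      simp only [k]
      congr 1
      exact Complex.ext (by simp) (by simp [hz0])
    · intro z hz w hw h
      have hz0 : z.im = 0 := (Finset.mem_filter.mp hz).2
      have hw0 : w.im = 0 := (Finset.mem_filter.mp hw).2
      exact Complex.ext h (by rw [hz0, hw0])
  -- every order `k c`, `c ∈ Z`, is at most `N(T)`
  have hkN : ∀ c ∈ Z, k c ≤ zetaZeroCount T := by
    intro c hc
    obtain ⟨z, hz, rfl⟩ := Finset.mem_image.mp hc
    have hzB : z ∈ B := (Finset.mem_filter.mp hz).1
    have hz0 : z.im = 0 := (Finset.mem_filter.mp hz).2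
    have hzre : ((z.re : ℝ) : ℂ) = z := Complex.ext (by simp) (by simp [hz0])
    rw [← sum_analyticOrderNatAt_eq_zetaZeroCount T, ← hB]
    simp only [k, hzre]
    exact Finset.single_le_sum (fun w _ => Nat.zero_le _) hzB
  -- the zeros of the limit on `[0, T]` lie in `Z`
  have hgzero : ∀ x ∈ Icc (0 : ℝ) T, f x = 0 → x ∈ Z := by
    intro x hx hfx
    have hΞx : riemannXiUpper x = 0 := Complex.ext (by simpa [f] using hfx) (by simpa using hΞreal x)
    have hx0 : 0 < x := by
      rcases hx.1.eq_or_lt with h | h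
      · exact absurd (show (x : ℂ).re = 0 by simp [← h]) (re_ne_zero_of_riemannXiUpper_eq_zero hΞx)
      · exact h
    refine Finset.mem_image.mpr ⟨(x : ℂ), Finset.mem_filter.mpr ⟨?_, by simp⟩, by simp⟩
    exact (Set.Finite.mem_toFinset _).mpr ⟨hΞx, by simpa using hx0, by simpa using hx.2⟩
  -- upper semicontinuity of the real zero count
  have hev : ∀ᶠ t : ℝ in atTop, {x | x ∈ Icc (0 : ℝ) T ∧ g t x = 0}.Finite ∧
      {x | x ∈ Icc (0 : ℝ) T ∧ g t x = 0}.ncard ≤ ∑ c ∈ Z, k c := by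
    refine eventually_ncard_zeros_le (N := zetaZeroCount T)
      (contDiff_re_ofReal (n := 0) hΞd).continuous hgzero ?_ ?_ hkN hsmooth
      (by simpa using hconv 0 (Nat.zero_le _)) ?_
    · intro c _
      exact ((contDiff_re_ofReal (n := ⊤) hΞd).continuous_iteratedDeriv
        (k c) (by exact_mod_cast le_top)).continuousAt
    · intro c _
      rw [iteratedDeriv_re_ofReal hΞd]
      have him := im_iteratedDeriv_ofReal_eq_zero hΞd hΞreal (k c) c
      exact fun h => iteratedDeriv_analyticOrderNatAt_ne_zero (c : ℂ)
        (Complex.ext (by simpa using h) (by simpa using him))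
    · intro c hc
      exact hconv (k c) (hkN c hc)
  obtain ⟨t, ⟨hfin, hle⟩, hcount⟩ := (hev.and hC).exists
  have hsub : {x : ℝ | 0 < x ∧ x ≤ T ∧ g t x = 0} ⊆ {x | x ∈ Icc (0 : ℝ) T ∧ g t x = 0} := by
    rintro x ⟨hx0, hxT, hgx⟩
    exact ⟨⟨hx0.le, hxT⟩, hgx⟩
  have hbound : ∑ z ∈ B, analyticOrderNatAt riemannXiUpper z ≤ ∑ c ∈ Z, k c := by
    have h1 : (zetaZeroCount T : ℕ∞) ≤ ({x | x ∈ Icc (0 : ℝ) T ∧ g t x = 0}.ncard : ℕ∞) := by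
      rw [← hcount, hfin.cast_ncard_eq]
      exact Set.encard_le_encard hsub
    rw [hB, sum_analyticOrderNatAt_eq_zetaZeroCount]
    exact (by exact_mod_cast h1 : zetaZeroCount T ≤ _).trans hle
  have hzero_sum : ∑ z ∈ B.filter (fun z => ¬ z.im = 0), analyticOrderNatAt riemannXiUpper z = 0 := by
    have := hbound; rw [hsplit, ← hreal_sum] at this; omega
  intro z hz hz0 hzT
  by_contra hzim
  have hzB : z ∈ B.filter (fun z => ¬ z.im = 0) :=
    Finset.mem_filter.mpr ⟨(Set.Finite.mem_toFinset _).mpr ⟨hz, hz0, hzT⟩, hzim⟩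
  have h1 : 1 ≤ analyticOrderNatAt riemannXiUpper z := one_le_analyticOrderNatAt_of_zero hz
  have := Finset.single_le_sum (fun w _ => Nat.zero_le (analyticOrderNatAt riemannXiUpper w)) hzB
  omega

/-- **G22-T, real-axis form.** Let `g_t : ℝ → ℝ` be smooth real functions such that, for every
`T > 0`, eventually `#{x ∈ (0, T] : g_t(x) = 0} = N(T)` (SC-2) and `g_t → (x ↦ Ξ(x))` in
`C^∞([0, T])` (every derivative uniformly on `[0, T]`). Then the Riemann Hypothesis holds. SC-3 of
idea-3 (uniform convergence of entire real-even `e^{-α_t} û_t` on thin complex rectangles) implies the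
second hypothesis for `g_t = Re(e^{-α_t} û_t)|_ℝ` by `RealZeroCount.tendstoUniformlyOn_re_iteratedDeriv`.
A pure implication; nothing here is, or suggests, a proof of RH. -/
theorem riemannHypothesis_of_count_of_smoothConvergence {g : ℝ → ℝ → ℝ}
    (hsmooth : ∀ (t : ℝ) (n : ℕ), ContDiff ℝ n (g t))
    (hC : ∀ T : ℝ, 0 < T → ∀ᶠ t : ℝ in atTop,
      {x : ℝ | 0 < x ∧ x ≤ T ∧ g t x = 0}.encard = (zetaZeroCount T : ℕ∞))
    (hconv : ∀ T : ℝ, 0 < T → ∀ k : ℕ,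
      TendstoUniformlyOn (fun t => iteratedDeriv k (g t))
        (iteratedDeriv k fun x : ℝ => (riemannXiUpper x).re) atTop (Icc 0 T)) :
    RiemannHypothesis := by
  have key : ∀ T : ℝ, 0 < T → ∀ z : ℂ, riemannXiUpper z = 0 → 0 < z.re → z.re ≤ T → z.im = 0 :=
    fun T hT0 => im_eq_zero_of_count_of_smoothConvergence
      (Eventually.of_forall fun t => hsmooth t _) (hC T hT0) (fun k _ => hconv T hT0 k)
  refine (riemannHypothesis_iff_im_eq_zero_of_riemannXiUpper_eq_zero_holds :
    RiemannHypothesis ↔ _).mpr fun z hz => ?_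
  rcases lt_trichotomy z.re 0 with hre | hre | hre
  · have hz' : riemannXiUpper (-z) = 0 := by rw [riemannXiUpper_neg]; exact hz
    have := key ((-z).re) (by simp; linarith) (-z) hz' (by simp; linarith) le_rfl
    simpa using this
  · exact absurd hre (re_ne_zero_of_riemannXiUpper_eq_zero hz)
  · exact key z.re hre z hz hre le_rfl

/-! Axiom census (expected `propext`, `Classical.choice`, `Quot.sound`). -/
#print axioms riemannHypothesis_of_count_of_smoothConvergence

end CountThin

end Summit.RiemannHypothesis.RiemannHypothesis.Theorems

end
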